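import Summits.AnomalousDissipation.AnomalousDissipation.Theorems.SawtoothPulseCascadeK1LocalisedCascadeKHLineKernelFourier

/-!
# K2 lane (route-2 `SawtoothPulseCascade`, crux dir `K1LocalisedCascade`): the periodised line kernel as a Bloch function on the whole line — continuity, quasi-periodicity, mode form, POLE-FREE kink-pair combinations

Helper file of the K2 lane (ACL item stmt-AnomalousDissipation-19491; arbiter A28-11, the corner law).  p4's kernel is the quasi-periodic extension
`G(u) = e^{2πiβ⌊u⌋} K(u − ⌊u⌋)` of the closed form `K` on `[0,1)` (`…KHForcingPieces`, hypotheses `hK`, `hG`).  Proved here, for `a > 0`: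
* `continuous_blochKernel` (via `ContinuousOn.comp_fract''` and `K(1) = e^{2πiβ}K(0)`), `blochKernel_add_one` (`G(u+1) = e^{2πiβ}G(u)`);
* `blochKernel_hasSum` — the MODE FORM on the whole line: `−G(u) = Σ_m e^{2πi(β+m)u}/(4π²(a²+(β+m)²))` (tree `lineKernel_fourier_hasSum` on `[0,1)` + the
  Bloch shift), hence `norm_blochKernel_le` (`‖G(u)‖ ≤ −Σ₀(a,β)/(2π)`);
* the two KINK-PAIR COMBINATIONS of the corner law: for `|β| ≤ ½`,
  `‖G(u+½)e^{−iπβ/2} − G(u)e^{iπβ/2}‖ ≤ 2/3` (**pole-free**: the `m = 0` mode cancels exactly, the others are `≤ 2/(π²m²)`), and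
  `‖G(u+½)e^{−iπβ/2} + G(u)e^{iπβ/2}‖ ≤ 2/(4π²(a²+β²)) + 2/3` (the pole `m = 0` once, the rest bounded) — uniformly in `u` and in `a`.
No definitions; no statement about the crux. [cite: Drazin2002, §8.3 (8.36)–(8.38)] [problem: turb]
-/

-- `Summit.<Summit>.<Problem>`: single-conjunct summit, the duplicate namespace segment is deliberate.
set_option linter.dupNamespace false

noncomputable section

namespace Summit.AnomalousDissipation.AnomalousDissipation.Theorems.SawtoothPulseCascade.K2PhaseBudget

open Set MeasureTheory intervalIntegral Literature.Analysis.FluidPDE.SawtoothCascade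

section kernel

variable {a β : ℝ} {K G : ℝ → ℂ}

/-! ## §1 Continuity and quasi-periodicity of the Bloch extension -/

/-- `K(1) = e^{2πiβ} K(0)`: the closed form matches across the period (the lattice sum is a continuous function of `u`). [cite: Drazin2002, §8.3 (8.36)–(8.38)] -/
theorem lineKernelK_one (ha : 0 < a) (β : ℝ)
    (hK : K = fun r : ℝ => (-((Real.exp (-(2 * Real.pi * a * r)) : ℂ) /
            (1 - starRingEnd ℂ (Complex.exp (2 * Real.pi * β * Complex.I)) * (Real.exp (-(2 * Real.pi * a)) : ℂ))
          + (Real.exp (2 * Real.pi * a * (r - 1)) : ℂ) * Complex.exp (2 * Real.pi * β * Complex.I) /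
            (1 - Complex.exp (2 * Real.pi * β * Complex.I) * (Real.exp (-(2 * Real.pi * a)) : ℂ))) /
        (2 * (2 * Real.pi * a) : ℂ))) :
    K 1 = Complex.exp (2 * Real.pi * β * Complex.I) * K 0 := by
  set z : ℂ := Complex.exp (2 * Real.pi * β * Complex.I) with hz
  set w : ℂ := starRingEnd ℂ z with hw
  set q : ℝ := Real.exp (-(2 * Real.pi * a)) with hq
  have hzn : ‖z‖ = 1 := by
    rw [hz, show (2 * Real.pi * β * Complex.I : ℂ) = ((2 * Real.pi * β : ℝ) : ℂ) * Complex.I by push_cast; ring]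
    exact Complex.norm_exp_ofReal_mul_I _
  have hwn : ‖w‖ = 1 := by rw [hw, Complex.norm_conj]; exact hzn
  have hzw : z * w = 1 := by rw [hw, Complex.mul_conj, Complex.normSq_eq_norm_sq, hzn]; simp
  have hq0 : 0 < q := Real.exp_pos _
  have hq1 : q < 1 := by rw [hq]; exact Real.exp_lt_one_iff.2 (by nlinarith [Real.pi_pos])
  have hd1 : 1 - w * (q : ℂ) ≠ 0 := one_sub_mul_ne_zero hwn hq0.le hq1
  have hd2 : 1 - z * (q : ℂ) ≠ 0 := one_sub_mul_ne_zero hzn hq0.le hq1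
  have hκ : (2 * (2 * Real.pi * a) : ℂ) ≠ 0 := by
    have : (0 : ℝ) < 2 * (2 * Real.pi * a) := by positivity
    exact_mod_cast this.ne'
  have hK0 : K 0 = -(1 / (1 - w * (q : ℂ)) + (q : ℂ) * z / (1 - z * (q : ℂ))) / (2 * (2 * Real.pi * a) : ℂ) := by
    simp only [hK, mul_zero, neg_zero, Real.exp_zero, Complex.ofReal_one, zero_sub, mul_neg_one]
    rw [← hq]
  have hK1 : K 1 = -((q : ℂ) / (1 - w * (q : ℂ)) + z / (1 - z * (q : ℂ))) / (2 * (2 * Real.pi * a) : ℂ) := by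
    simp only [hK, mul_one, sub_self, mul_zero, Real.exp_zero, Complex.ofReal_one, one_mul]
    rw [← hq]
  rw [hK0, hK1]
  have hz0 : z ≠ 0 := by rw [hz]; exact Complex.exp_ne_zero _
  have hwz : w = z⁻¹ := (inv_eq_of_mul_eq_one_right hzw).symm
  rw [hwz]
  have hzq : z - (q : ℂ) ≠ 0 := by
    intro h0
    have : ‖z‖ = q := by rw [sub_eq_zero.1 h0, Complex.norm_real, Real.norm_eq_abs, abs_of_pos hq0]
    linarith
  have hd2' : 1 - (q : ℂ) * z ≠ 0 := by rwa [mul_comm] at hd2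
  have ha' : (a : ℂ) ≠ 0 := by exact_mod_cast ha.ne'
  have hπ' : (Real.pi : ℂ) ≠ 0 := by exact_mod_cast Real.pi_pos.ne'
  field_simp
  ring

/-- **The Bloch extension of the kernel is continuous on the whole line.** [cite: Drazin2002, §8.3 (8.36)–(8.38)] -/
theorem continuous_blochKernel (ha : 0 < a) (β : ℝ)
    (hK : K = fun r : ℝ => (-((Real.exp (-(2 * Real.pi * a * r)) : ℂ) /
            (1 - starRingEnd ℂ (Complex.exp (2 * Real.pi * β * Complex.I)) * (Real.exp (-(2 * Real.pi * a)) : ℂ))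
          + (Real.exp (2 * Real.pi * a * (r - 1)) : ℂ) * Complex.exp (2 * Real.pi * β * Complex.I) /
            (1 - Complex.exp (2 * Real.pi * β * Complex.I) * (Real.exp (-(2 * Real.pi * a)) : ℂ))) /
        (2 * (2 * Real.pi * a) : ℂ)))
    (hG : ∀ u : ℝ, G u = Complex.exp (2 * Real.pi * β * (⌊u⌋ : ℝ) * Complex.I) * K (u - ⌊u⌋)) : Continuous G := by
  -- `h(x) = e^{−2πiβx} K(x)` is continuous with `h 0 = h 1`, so `h ∘ fract` is continuous
  set h : ℝ → ℂ := fun x => Complex.exp (-(2 * Real.pi * β * x * Complex.I)) * K x with hh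
  have hKc : Continuous K := by rw [hK]; fun_prop
  have hhc : Continuous h := by rw [hh]; fun_prop
  have h01 : h 0 = h 1 := by
    simp only [hh]
    rw [lineKernelK_one ha β hK]
    simp only [Complex.ofReal_zero, mul_zero, zero_mul, neg_zero, Complex.exp_zero, one_mul, Complex.ofReal_one, mul_one]
    rw [← mul_assoc, ← Complex.exp_add, show -(2 * Real.pi * β * Complex.I) + 2 * Real.pi * β * Complex.I = (0 : ℂ) by ring, Complex.exp_zero, one_mul]
  have hfr : Continuous (h ∘ Int.fract) := ContinuousOn.comp_fract'' hhc.continuousOn h01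
  have hGe : G = fun u : ℝ => Complex.exp (2 * Real.pi * β * u * Complex.I) * (h ∘ Int.fract) u := by
    funext u
    rw [hG u, Function.comp_apply, hh]
    dsimp only
    rw [Int.fract, ← mul_assoc, ← Complex.exp_add]
    congr 2
    push_cast
    ring
  rw [hGe]
  exact (by fun_prop : Continuous fun u : ℝ => Complex.exp (2 * Real.pi * β * u * Complex.I)).mul hfr

/-- **Quasi-periodicity:** `G(u + 1) = e^{2πiβ} G(u)`. [cite: Drazin2002, §8.3 (8.36)–(8.38)] -/
theorem blochKernel_add_one (β : ℝ)
    (hG : ∀ u : ℝ, G u = Complex.exp (2 * Real.pi * β * (⌊u⌋ : ℝ) * Complex.I) * K (u - ⌊u⌋)) (u : ℝ) :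
    G (u + 1) = Complex.exp (2 * Real.pi * β * Complex.I) * G u := by
  rw [hG, hG u, Int.floor_add_one, ← mul_assoc, ← Complex.exp_add]
  congr 1
  · congr 1; push_cast; ring
  · push_cast; ring_nf

/-- `G(u − 1) = e^{−2πiβ} G(u)`. [cite: Drazin2002, §8.3 (8.36)–(8.38)] -/
theorem blochKernel_sub_one (β : ℝ)
    (hG : ∀ u : ℝ, G u = Complex.exp (2 * Real.pi * β * (⌊u⌋ : ℝ) * Complex.I) * K (u - ⌊u⌋)) (u : ℝ) :
    G (u - 1) = Complex.exp (-(2 * Real.pi * β * Complex.I)) * G u := by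
  have h := blochKernel_add_one β hG (u - 1)
  rw [sub_add_cancel] at h
  rw [h, ← mul_assoc, ← Complex.exp_add, show -(2 * Real.pi * β * Complex.I) + 2 * Real.pi * β * Complex.I = (0 : ℂ) by ring,
    Complex.exp_zero, one_mul]

/-! ## §2 The mode form on the whole line and the sup bound -/

/-- **Mode form of the Bloch kernel on the whole line:** `−G(u) = Σ_{m∈ℤ} e^{2πi(β+m)u}/(4π²(a² + (β+m)²))` for every real `u`
(tree `lineKernel_fourier_hasSum` on `[0,1)` and the Bloch shift `e^{2πi(β+m)⌊u⌋} = e^{2πiβ⌊u⌋}`). [cite: Drazin2002, §8.3 (8.36)–(8.38)] -/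
theorem blochKernel_hasSum (ha : 0 < a) (β : ℝ)
    (hK : K = fun r : ℝ => (-((Real.exp (-(2 * Real.pi * a * r)) : ℂ) /
            (1 - starRingEnd ℂ (Complex.exp (2 * Real.pi * β * Complex.I)) * (Real.exp (-(2 * Real.pi * a)) : ℂ))
          + (Real.exp (2 * Real.pi * a * (r - 1)) : ℂ) * Complex.exp (2 * Real.pi * β * Complex.I) /
            (1 - Complex.exp (2 * Real.pi * β * Complex.I) * (Real.exp (-(2 * Real.pi * a)) : ℂ))) /
        (2 * (2 * Real.pi * a) : ℂ)))
    (hG : ∀ u : ℝ, G u = Complex.exp (2 * Real.pi * β * (⌊u⌋ : ℝ) * Complex.I) * K (u - ⌊u⌋)) (u : ℝ) :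
    HasSum (fun m : ℤ => (((1 / (4 * Real.pi ^ 2 * (a ^ 2 + (β + m) ^ 2)) : ℝ) : ℂ)) *
        Complex.exp (2 * Real.pi * ((β : ℂ) + m) * u * Complex.I)) (-G u) := by
  have hr0 : 0 ≤ u - ⌊u⌋ := by linarith [Int.floor_le u]
  have hr1 : u - ⌊u⌋ < 1 := by linarith [Int.lt_floor_add_one u]
  have h := (lineKernel_fourier_hasSum ha β hK hr0 hr1).mul_left (Complex.exp (2 * Real.pi * β * (⌊u⌋ : ℝ) * Complex.I))
  rw [hG u, ← mul_neg]
  refine h.congr_fun fun m => ?_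
  rw [mul_left_comm, ← Complex.exp_add]
  congr 1
  have e : (2 * Real.pi * β * (⌊u⌋ : ℝ) * Complex.I : ℂ) + 2 * Real.pi * ((β : ℂ) + m) * ((u - ⌊u⌋ : ℝ) : ℂ) * Complex.I =
      2 * Real.pi * ((β : ℂ) + m) * u * Complex.I + ((-(m * ⌊u⌋) : ℤ) : ℂ) * (2 * Real.pi * Complex.I) := by
    push_cast; ring
  rw [e, Complex.exp_add, Complex.exp_int_mul_two_pi_mul_I, mul_one]

/-- **Sup bound:** `‖G(u)‖ ≤ −Σ₀(a,β)/(2π)` (`= Σ_m 1/(4π²(a²+(β+m)²))`, tree `hasSum_lineWeights`) for every real `u`. [cite: Drazin2002, §8.3 (8.36)–(8.38)] -/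
theorem norm_blochKernel_le (ha : 0 < a) (β : ℝ)
    (hK : K = fun r : ℝ => (-((Real.exp (-(2 * Real.pi * a * r)) : ℂ) /
            (1 - starRingEnd ℂ (Complex.exp (2 * Real.pi * β * Complex.I)) * (Real.exp (-(2 * Real.pi * a)) : ℂ))
          + (Real.exp (2 * Real.pi * a * (r - 1)) : ℂ) * Complex.exp (2 * Real.pi * β * Complex.I) /
            (1 - Complex.exp (2 * Real.pi * β * Complex.I) * (Real.exp (-(2 * Real.pi * a)) : ℂ))) /
        (2 * (2 * Real.pi * a) : ℂ)))
    (hG : ∀ u : ℝ, G u = Complex.exp (2 * Real.pi * β * (⌊u⌋ : ℝ) * Complex.I) * K (u - ⌊u⌋)) (u : ℝ) :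
    ‖G u‖ ≤ -sawSigma0 a β / (2 * Real.pi) := by
  have h := blochKernel_hasSum ha β hK hG u
  rw [← norm_neg, ← h.tsum_eq]
  refine tsum_of_norm_bounded (hasSum_lineWeights ha β) fun m => le_of_eq ?_
  rw [norm_mul, Complex.norm_real, Real.norm_eq_abs, abs_of_nonneg (by positivity),
    show (2 * Real.pi * ((β : ℂ) + m) * u * Complex.I : ℂ) = ((2 * Real.pi * (β + m) * u : ℝ) : ℂ) * Complex.I by push_cast; ring,
    Complex.norm_exp_ofReal_mul_I, mul_one]

/-! ## §3 The kink-pair combinations: the `m = 0` pole cancels in the difference -/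

/-- `Σ_{m∈ℤ} 2/(π²m²) = 2/3` (the `m = 0` term is `2/0 = 0`). [folklore] -/
theorem hasSum_two_div_pi_sq_mul_sq : HasSum (fun m : ℤ => 2 / (Real.pi ^ 2 * (m : ℝ) ^ 2)) (2 / 3) := by
  have hπ : Real.pi ^ 2 ≠ 0 := by positivity
  have h1 : HasSum (fun n : ℕ => 1 / (n : ℝ) ^ 2) (Real.pi ^ 2 / 6) := hasSum_zeta_two
  have h2' : HasSum (fun n : ℕ => (fun k : ℕ => 1 / (k : ℝ) ^ 2) (n + 1)) (Real.pi ^ 2 / 6) :=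
    (hasSum_nat_add_iff (f := fun k : ℕ => 1 / (k : ℝ) ^ 2) 1 (g := Real.pi ^ 2 / 6)).mpr (by simpa using h1)
  have h2 : HasSum (fun n : ℕ => 1 / ((n : ℝ) + 1) ^ 2) (Real.pi ^ 2 / 6) := by
    refine h2'.congr_fun fun n => ?_
    push_cast; ring
  have hZ : HasSum (fun m : ℤ => 1 / (m : ℝ) ^ 2) (Real.pi ^ 2 / 6 + Real.pi ^ 2 / 6) := by
    refine HasSum.of_nat_of_neg_add_one ?_ ?_
    · refine h1.congr_fun fun n => ?_; push_cast; ring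
    · refine h2.congr_fun fun n => ?_; push_cast; ring
  have hZ' := hZ.mul_left (2 / Real.pi ^ 2)
  have hv : 2 / Real.pi ^ 2 * (Real.pi ^ 2 / 6 + Real.pi ^ 2 / 6) = 2 / 3 := by field_simp; ring
  rw [hv] at hZ'
  refine hZ'.congr_fun fun m => ?_
  rw [mul_one_div, div_div]

/-- Off the central mode the line weights are `≤ 1/(π²m²)` when `|β| ≤ ½` (`(β+m)² ≥ m²/4`). [folklore] -/
theorem lineWeight_le_inv_pi_sq_mul_sq {a : ℝ} (ha : 0 < a) {β : ℝ} (hβ : |β| ≤ 1 / 2) {m : ℤ} (hm : m ≠ 0) :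
    1 / (4 * Real.pi ^ 2 * (a ^ 2 + (β + m) ^ 2)) ≤ 1 / (Real.pi ^ 2 * (m : ℝ) ^ 2) := by
  have hβ1 : -(1 / 2) ≤ β := by linarith [abs_le.1 hβ]
  have hβ2 : β ≤ 1 / 2 := by linarith [abs_le.1 hβ]
  have hm2 : (m : ℝ) ^ 2 ≤ 4 * (β + m) ^ 2 := by
    rcases lt_or_gt_of_ne hm with h | h
    · have hm' : (m : ℝ) ≤ -1 := by exact_mod_cast Int.le_sub_one_of_lt h
      nlinarith [mul_nonneg_of_nonpos_of_nonpos (show 2 * β + m ≤ 0 by linarith) (show 2 * β + 3 * m ≤ 0 by linarith)]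
    · have hm' : (1 : ℝ) ≤ m := by exact_mod_cast h
      nlinarith [mul_nonneg (show 0 ≤ 2 * β + m by linarith) (show 0 ≤ 2 * β + 3 * m by linarith)]
  have hm0 : (0 : ℝ) < (m : ℝ) ^ 2 := by
    have : (m : ℝ) ≠ 0 := by exact_mod_cast hm
    exact lt_of_le_of_ne (sq_nonneg _) (Ne.symm (pow_ne_zero 2 this))
  have hπ := Real.pi_pos
  rw [div_le_div_iff₀ (by positivity) (mul_pos (by positivity) hm0), one_mul, one_mul]
  nlinarith [mul_le_mul_of_nonneg_left hm2 (le_of_lt (by positivity : (0 : ℝ) < Real.pi ^ 2)), sq_nonneg a,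
    mul_nonneg (le_of_lt (by positivity : (0 : ℝ) < Real.pi ^ 2)) (sq_nonneg a)]

/-- **The antisymmetric kink-pair kernel is pole-free:** for `|β| ≤ ½` and every real `u`,
`‖G(u+½)·e^{−iπβ/2} − G(u)·e^{iπβ/2}‖ ≤ 2/3` — in the mode form the `m = 0` term is `w₀e^{2πiβu}(e^{iπβ}e^{−iπβ/2} − e^{iπβ/2}) = 0`, every other term
is `≤ 2w_m ≤ 2/(π²m²)`. [cite: Drazin2002, §8.3 (8.36)–(8.38)] -/
theorem norm_blochKernel_pair_sub_le (ha : 0 < a) {β : ℝ} (hβ : |β| ≤ 1 / 2)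
    (hK : K = fun r : ℝ => (-((Real.exp (-(2 * Real.pi * a * r)) : ℂ) /
            (1 - starRingEnd ℂ (Complex.exp (2 * Real.pi * β * Complex.I)) * (Real.exp (-(2 * Real.pi * a)) : ℂ))
          + (Real.exp (2 * Real.pi * a * (r - 1)) : ℂ) * Complex.exp (2 * Real.pi * β * Complex.I) /
            (1 - Complex.exp (2 * Real.pi * β * Complex.I) * (Real.exp (-(2 * Real.pi * a)) : ℂ))) /
        (2 * (2 * Real.pi * a) : ℂ)))
    (hG : ∀ u : ℝ, G u = Complex.exp (2 * Real.pi * β * (⌊u⌋ : ℝ) * Complex.I) * K (u - ⌊u⌋)) (u : ℝ) :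
    ‖G (u + 1 / 2) * Complex.exp (-((Real.pi * β / 2 : ℝ) : ℂ) * Complex.I) - G u * Complex.exp (((Real.pi * β / 2 : ℝ) : ℂ) * Complex.I)‖ ≤ 2 / 3 := by
  set ep : ℂ := Complex.exp (((Real.pi * β / 2 : ℝ) : ℂ) * Complex.I) with hep
  set em : ℂ := Complex.exp (-((Real.pi * β / 2 : ℝ) : ℂ) * Complex.I) with hem
  have h1 := blochKernel_hasSum ha β hK hG u
  have h2 := blochKernel_hasSum ha β hK hG (u + 1 / 2)
  have h := (h2.mul_right em).sub (h1.mul_right ep)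
  have hval : -G (u + 1 / 2) * em - -G u * ep = -(G (u + 1 / 2) * em - G u * ep) := by ring
  rw [hval] at h
  rw [← norm_neg, ← h.tsum_eq]
  refine tsum_of_norm_bounded hasSum_two_div_pi_sq_mul_sq fun m => ?_
  -- the `m`-th term
  have hw0 : 0 ≤ (1 / (4 * Real.pi ^ 2 * (a ^ 2 + (β + m) ^ 2)) : ℝ) := by positivity
  have hfac : (((1 / (4 * Real.pi ^ 2 * (a ^ 2 + (β + m) ^ 2)) : ℝ) : ℂ)) * Complex.exp (2 * Real.pi * ((β : ℂ) + m) * ((u + 1 / 2 : ℝ) : ℂ) * Complex.I) * em -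
        (((1 / (4 * Real.pi ^ 2 * (a ^ 2 + (β + m) ^ 2)) : ℝ) : ℂ)) * Complex.exp (2 * Real.pi * ((β : ℂ) + m) * u * Complex.I) * ep =
      (((1 / (4 * Real.pi ^ 2 * (a ^ 2 + (β + m) ^ 2)) : ℝ) : ℂ)) * Complex.exp (((2 * Real.pi * (β + m) * u : ℝ) : ℂ) * Complex.I) *
        (Complex.exp (((Real.pi * m + Real.pi * β / 2 : ℝ) : ℂ) * Complex.I) - Complex.exp (((Real.pi * β / 2 : ℝ) : ℂ) * Complex.I)) := by
    have e1 : Complex.exp (2 * Real.pi * ((β : ℂ) + m) * ((u + 1 / 2 : ℝ) : ℂ) * Complex.I) * em =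
        Complex.exp (((2 * Real.pi * (β + m) * u : ℝ) : ℂ) * Complex.I) * Complex.exp (((Real.pi * m + Real.pi * β / 2 : ℝ) : ℂ) * Complex.I) := by
      rw [hem, ← Complex.exp_add, ← Complex.exp_add]; congr 1; push_cast; ring
    have e2 : Complex.exp (2 * Real.pi * ((β : ℂ) + m) * u * Complex.I) * ep =
        Complex.exp (((2 * Real.pi * (β + m) * u : ℝ) : ℂ) * Complex.I) * Complex.exp (((Real.pi * β / 2 : ℝ) : ℂ) * Complex.I) := by
      rw [hep, ← Complex.exp_add, ← Complex.exp_add]; congr 1; push_cast; ring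
    rw [mul_assoc, e1, mul_assoc _ _ ep, e2]; ring
  rw [hfac, norm_mul, norm_mul, Complex.norm_real, Real.norm_eq_abs, abs_of_nonneg hw0, Complex.norm_exp_ofReal_mul_I, mul_one]
  rcases eq_or_ne m 0 with hm | hm
  · subst hm
    simp
  · have hd : ‖Complex.exp (((Real.pi * m + Real.pi * β / 2 : ℝ) : ℂ) * Complex.I) - Complex.exp (((Real.pi * β / 2 : ℝ) : ℂ) * Complex.I)‖ ≤ 2 := by
      refine (norm_sub_le _ _).trans ?_
      rw [Complex.norm_exp_ofReal_mul_I, Complex.norm_exp_ofReal_mul_I]; norm_num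
    calc (1 / (4 * Real.pi ^ 2 * (a ^ 2 + (β + m) ^ 2)) : ℝ) *
          ‖Complex.exp (((Real.pi * m + Real.pi * β / 2 : ℝ) : ℂ) * Complex.I) - Complex.exp (((Real.pi * β / 2 : ℝ) : ℂ) * Complex.I)‖
        ≤ (1 / (Real.pi ^ 2 * (m : ℝ) ^ 2)) * 2 := mul_le_mul (lineWeight_le_inv_pi_sq_mul_sq ha hβ hm) hd (norm_nonneg _) (by positivity)
      _ = 2 / (Real.pi ^ 2 * (m : ℝ) ^ 2) := by ring

/-- **The symmetric kink-pair kernel: the pole once.** For `|β| ≤ ½` and every real `u`,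
`‖G(u+½)·e^{−iπβ/2} + G(u)·e^{iπβ/2}‖ ≤ 2/(4π²(a²+β²)) + 2/3`. [cite: Drazin2002, §8.3 (8.36)–(8.38)] -/
theorem norm_blochKernel_pair_add_le (ha : 0 < a) {β : ℝ} (hβ : |β| ≤ 1 / 2)
    (hK : K = fun r : ℝ => (-((Real.exp (-(2 * Real.pi * a * r)) : ℂ) /
            (1 - starRingEnd ℂ (Complex.exp (2 * Real.pi * β * Complex.I)) * (Real.exp (-(2 * Real.pi * a)) : ℂ))
          + (Real.exp (2 * Real.pi * a * (r - 1)) : ℂ) * Complex.exp (2 * Real.pi * β * Complex.I) /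
            (1 - Complex.exp (2 * Real.pi * β * Complex.I) * (Real.exp (-(2 * Real.pi * a)) : ℂ))) /
        (2 * (2 * Real.pi * a) : ℂ)))
    (hG : ∀ u : ℝ, G u = Complex.exp (2 * Real.pi * β * (⌊u⌋ : ℝ) * Complex.I) * K (u - ⌊u⌋)) (u : ℝ) :
    ‖G (u + 1 / 2) * Complex.exp (-((Real.pi * β / 2 : ℝ) : ℂ) * Complex.I) + G u * Complex.exp (((Real.pi * β / 2 : ℝ) : ℂ) * Complex.I)‖ ≤
      2 * (1 / (4 * Real.pi ^ 2 * (a ^ 2 + β ^ 2))) + 2 / 3 := by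
  set ep : ℂ := Complex.exp (((Real.pi * β / 2 : ℝ) : ℂ) * Complex.I) with hep
  set em : ℂ := Complex.exp (-((Real.pi * β / 2 : ℝ) : ℂ) * Complex.I) with hem
  have h1 := blochKernel_hasSum ha β hK hG u
  have h2 := blochKernel_hasSum ha β hK hG (u + 1 / 2)
  have h := (h2.mul_right em).add (h1.mul_right ep)
  have hval : -G (u + 1 / 2) * em + -G u * ep = -(G (u + 1 / 2) * em + G u * ep) := by ring
  rw [hval] at h
  rw [← norm_neg, ← h.tsum_eq]
  -- majorant: the pole at `m = 0` plus `2/(π²m²)`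
  have hmaj : HasSum (fun m : ℤ => (if m = 0 then 2 * (1 / (4 * Real.pi ^ 2 * (a ^ 2 + β ^ 2))) else 0) + 2 / (Real.pi ^ 2 * (m : ℝ) ^ 2))
      (2 * (1 / (4 * Real.pi ^ 2 * (a ^ 2 + β ^ 2))) + 2 / 3) :=
    (hasSum_ite_eq 0 _).add hasSum_two_div_pi_sq_mul_sq
  refine tsum_of_norm_bounded hmaj fun m => ?_
  have hw0 : 0 ≤ (1 / (4 * Real.pi ^ 2 * (a ^ 2 + (β + m) ^ 2)) : ℝ) := by positivity
  have hfac : (((1 / (4 * Real.pi ^ 2 * (a ^ 2 + (β + m) ^ 2)) : ℝ) : ℂ)) * Complex.exp (2 * Real.pi * ((β : ℂ) + m) * ((u + 1 / 2 : ℝ) : ℂ) * Complex.I) * em +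
        (((1 / (4 * Real.pi ^ 2 * (a ^ 2 + (β + m) ^ 2)) : ℝ) : ℂ)) * Complex.exp (2 * Real.pi * ((β : ℂ) + m) * u * Complex.I) * ep =
      (((1 / (4 * Real.pi ^ 2 * (a ^ 2 + (β + m) ^ 2)) : ℝ) : ℂ)) * Complex.exp (((2 * Real.pi * (β + m) * u : ℝ) : ℂ) * Complex.I) *
        (Complex.exp (((Real.pi * m + Real.pi * β / 2 : ℝ) : ℂ) * Complex.I) + Complex.exp (((Real.pi * β / 2 : ℝ) : ℂ) * Complex.I)) := by
    have e1 : Complex.exp (2 * Real.pi * ((β : ℂ) + m) * ((u + 1 / 2 : ℝ) : ℂ) * Complex.I) * em =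
        Complex.exp (((2 * Real.pi * (β + m) * u : ℝ) : ℂ) * Complex.I) * Complex.exp (((Real.pi * m + Real.pi * β / 2 : ℝ) : ℂ) * Complex.I) := by
      rw [hem, ← Complex.exp_add, ← Complex.exp_add]; congr 1; push_cast; ring
    have e2 : Complex.exp (2 * Real.pi * ((β : ℂ) + m) * u * Complex.I) * ep =
        Complex.exp (((2 * Real.pi * (β + m) * u : ℝ) : ℂ) * Complex.I) * Complex.exp (((Real.pi * β / 2 : ℝ) : ℂ) * Complex.I) := by
      rw [hep, ← Complex.exp_add, ← Complex.exp_add]; congr 1; push_cast; ring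
    rw [mul_assoc, e1, mul_assoc _ _ ep, e2]; ring
  rw [hfac, norm_mul, norm_mul, Complex.norm_real, Real.norm_eq_abs, abs_of_nonneg hw0, Complex.norm_exp_ofReal_mul_I, mul_one]
  have hd : ‖Complex.exp (((Real.pi * m + Real.pi * β / 2 : ℝ) : ℂ) * Complex.I) + Complex.exp (((Real.pi * β / 2 : ℝ) : ℂ) * Complex.I)‖ ≤ 2 := by
    refine (norm_add_le _ _).trans ?_
    rw [Complex.norm_exp_ofReal_mul_I, Complex.norm_exp_ofReal_mul_I]; norm_num
  rcases eq_or_ne m 0 with hm | hm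
  · subst hm
    simp only [Int.cast_zero, add_zero, if_true, mul_zero, ne_eq, OfNat.ofNat_ne_zero, not_false_eq_true, zero_pow, div_zero]
    rw [mul_comm]
    simp only [Int.cast_zero, mul_zero, zero_add] at hd ⊢
    exact mul_le_mul_of_nonneg_right hd (by positivity)
  · rw [if_neg hm, zero_add]
    calc (1 / (4 * Real.pi ^ 2 * (a ^ 2 + (β + m) ^ 2)) : ℝ) *
          ‖Complex.exp (((Real.pi * m + Real.pi * β / 2 : ℝ) : ℂ) * Complex.I) + Complex.exp (((Real.pi * β / 2 : ℝ) : ℂ) * Complex.I)‖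
        ≤ (1 / (Real.pi ^ 2 * (m : ℝ) ^ 2)) * 2 := mul_le_mul (lineWeight_le_inv_pi_sq_mul_sq ha hβ hm) hd (norm_nonneg _) (by positivity)
      _ = 2 / (Real.pi ^ 2 * (m : ℝ) ^ 2) := by ring

end kernel

end Summit.AnomalousDissipation.AnomalousDissipation.Theorems.SawtoothPulseCascade.K2PhaseBudget

end
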